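import Summits.FinalStateConjecture.FinalStateConjecture.Theorems.PhotonSphereChannelsWindowedShellChannelsStubOutVirialStrip
import Summits.FinalStateConjecture.FinalStateConjecture.Theorems.PhotonSphereChannelsChannelsResolveTameDevelopmentsRTotalEnergyConservation

/-!
# Crux `WindowedShellChannels` (stmt-FinalStateConjecture-14085), line `Sketch` — stub `stub_outVirial`:
# the virial law of the characteristic split OUT/IN for `ψ_tt − ψ_xx + Vψ = 0` (part 2: assembly)

For `V ≥ 0` of class `C¹` with `|V′| ≤ K V`, single-peaked at `xp` (`(x − xp) V′(x) ≤ 0`), and a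
finite-energy global `C²` solution `ψ` of `ψ_tt − ψ_xx + Vψ = 0`, with
`OUT(t) := ½∫_{x>xp}[(ψ_t − ψ_x)² + Vψ²] + ½∫_{x<xp}[(ψ_t + ψ_x)² + Vψ²]` (all terms in `[0, ∞]`):
`OUT(t₁) + ∫₀^{t₁} V(xp) ψ(τ,xp)² dτ = OUT(0) + ∫₀^{t₁} (ψ_t² + ψ_x²)(τ,xp) dτ + ½ ∫₀^{t₁}∫_ℝ |V′| ψ²`
for `t₁ ≥ 0` (`stub_outVirial`, namespace `…Theorems.WindowedShellChannelsSketch`: the registered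
signature of the lead skeleton `Cruxes/WindowedShellChannels/Lines/Sketch.lean`).

Proof (`OutVirial.outVirial_fderiv`; `u = uncurry ψ`, `e = u_t² + u_x² + Vu²`, `P = u_t u_x`): by the two
half-strip identities of part 1 (`OutVirial.half_strip_identities`, file `…StubOutVirialStrip`: the
multiplier `f ≡ 1, β ≡ 0, φ = V/2` on `[0,t₁] × [xp, X]` and on `[0,t₁] × [X, xp]`, `X → ±∞`),
`OUT_R = ½∫_{x>xp} e − ∫_{x>xp} P`, `OUT_L = ½∫_{x<xp} e + ∫_{x<xp} P`, `E(t₁) = E(0)` and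
`−sgn(x − xp)V′ = |V′|`, the real identity holds; all its terms are nonnegative, so it is recast in `ℝ≥0∞`.
The conservation of the total energy in `[0, ∞]` of finite-energy solutions is `RW.totalEnergy_eq_totalEnergy`
(tree file `…ChannelsResolveTameDevelopmentsRTotalEnergyConservation`).  Standard material [folklore].
-/

noncomputable section

set_option linter.dupNamespace false

namespace Summit.FinalStateConjecture.FinalStateConjecture.Theorems.WindowedShellChannelsSketch

open Literature.Geometry.Lorentzian Literature.Geometry.Lorentzian.ReggeWheeler Filter Set MeasureTheory
open scoped ENNReal Topology

namespace OutVirial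

/-! ### Assembly in `ℝ≥0∞` -/

section Assembly

variable {u : ℝ × ℝ → ℝ} {V V' : ℝ → ℝ} {K : ℝ}

/-- `2⁻¹ |v| a² = |−(v/2) a²|` (the bulk `½|V′|u²` is `|B|`). -/
theorem half_abs_eq (a v : ℝ) : 2⁻¹ * (|v| * a ^ 2) = |-(v / 2 * a ^ 2)| := by
  rw [abs_neg, abs_mul, abs_div, abs_two, abs_of_nonneg (sq_nonneg a)]
  ring

/-- **The virial law of the characteristic split, Fréchet form.**  For a `C²` solution `u` of
`u_tt − u_xx + Vu = 0` on `ℝ × ℝ` (`V ≥ 0` of class `C¹`, `|V′| ≤ K V`, `(x − xp)V′ ≤ 0`) whose slices all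
have the same finite energy `E₀`, and `t₁ ≥ 0`:
`OUT(t₁) + ∫₀^{t₁} V(xp)u(·,xp)² = OUT(0) + ∫₀^{t₁} (u_t² + u_x²)(·,xp) + ½∬_{(0,t₁)×ℝ} |V′|u²` in `[0, ∞]`. -/
theorem outVirial_fderiv (hu : ContDiff ℝ 2 u) (hV : ∀ x, HasDerivAt V (V' x) x)
    (hV'c : Continuous V') (hV0 : ∀ x, 0 ≤ V x) (hK : ∀ x, |V' x| ≤ K * V x) {xp : ℝ}
    (hmono : ∀ x, (x - xp) * V' x ≤ 0)
    (hsol : ∀ z : ℝ × ℝ, fderiv ℝ (fderiv ℝ u) z (1, 0) (1, 0)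
      - fderiv ℝ (fderiv ℝ u) z (0, 1) (0, 1) + V z.2 * u z = 0)
    {e : ℝ × ℝ → ℝ}
    (he : ∀ z, e z = (fderiv ℝ u z (1, 0)) ^ 2 + (fderiv ℝ u z (0, 1)) ^ 2 + V z.2 * u z ^ 2)
    {E₀ : ℝ≥0∞} (hE₀ : E₀ ≠ ⊤) (hcons : ∀ t, ∫⁻ x, ENNReal.ofReal (e (t, x)) = E₀)
    {t₁ : ℝ} (ht₁ : 0 ≤ t₁) :
    (∫⁻ x in Ioi xp, ENNReal.ofReal
        (2⁻¹ * ((fderiv ℝ u (t₁, x) (1, 0) - fderiv ℝ u (t₁, x) (0, 1)) ^ 2 + V x * u (t₁, x) ^ 2)))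
      + (∫⁻ x in Iio xp, ENNReal.ofReal
        (2⁻¹ * ((fderiv ℝ u (t₁, x) (1, 0) + fderiv ℝ u (t₁, x) (0, 1)) ^ 2 + V x * u (t₁, x) ^ 2)))
      + ENNReal.ofReal (∫ τ in (0:ℝ)..t₁, V xp * u (τ, xp) ^ 2)
    = (∫⁻ x in Ioi xp, ENNReal.ofReal
        (2⁻¹ * ((fderiv ℝ u (0, x) (1, 0) - fderiv ℝ u (0, x) (0, 1)) ^ 2 + V x * u (0, x) ^ 2)))
      + (∫⁻ x in Iio xp, ENNReal.ofReal
        (2⁻¹ * ((fderiv ℝ u (0, x) (1, 0) + fderiv ℝ u (0, x) (0, 1)) ^ 2 + V x * u (0, x) ^ 2)))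
      + ENNReal.ofReal (∫ τ in (0:ℝ)..t₁,
          (fderiv ℝ u (τ, xp) (1, 0) ^ 2 + fderiv ℝ u (τ, xp) (0, 1) ^ 2))
      + ∫⁻ z in Ioo (0:ℝ) t₁ ×ˢ (univ : Set ℝ),
          ENNReal.ofReal (2⁻¹ * (|V' z.2| * u z ^ 2)) := by
  -- the densities of the multiplier `f ≡ 1, β ≡ 0, φ = V/2`
  obtain ⟨P, hP⟩ : ∃ P : ℝ × ℝ → ℝ, ∀ z, P z = fderiv ℝ u z (1, 0) * fderiv ℝ u z (0, 1) :=
    ⟨_, fun z => rfl⟩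
  obtain ⟨Q, hQ⟩ : ∃ Q : ℝ × ℝ → ℝ, ∀ z, Q z = 1 / 2 * (fderiv ℝ u z (1, 0) ^ 2
      + fderiv ℝ u z (0, 1) ^ 2) - V z.2 / 2 * u z ^ 2 := ⟨_, fun z => rfl⟩
  obtain ⟨Bk, hB⟩ : ∃ Bk : ℝ × ℝ → ℝ, ∀ z, Bk z = -(V' z.2 / 2 * u z ^ 2) := ⟨_, fun z => rfl⟩
  have hVd : Differentiable ℝ V := fun x => (hV x).differentiableAt
  have hec := WaveEnergy.continuous_energyDensity hu hVd he
  have he0 := WaveEnergy.energyDensity_nonneg hV0 he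
  have hfin : ∀ t, ∫⁻ x, ENNReal.ofReal (e (t, x)) < ⊤ := fun t => by
    rw [hcons]; exact hE₀.lt_top
  have hIe : ∀ t, Integrable (fun x => e (t, x)) := fun t => integrable_slice hu hVd hV0 he (hfin t)
  have hIP : ∀ t, Integrable (fun x => P (t, x)) := fun t => integrable_P_slice hu hV0 he hP (hIe t)
  have hstrip : IntegrableOn e (Ioc 0 t₁ ×ˢ univ) := integrableOn_strip hu hVd hV0 he hE₀ hcons t₁
  have hBstrip : IntegrableOn Bk (Ioc 0 t₁ ×ˢ univ) := integrableOn_Bk_strip hu hV'c hV0 hK he hB hstrip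
  -- the two half-strip identities (part 1, `…StubOutVirialStrip`)
  obtain ⟨hR, hL⟩ := half_strip_identities hu hV hV'c hV0 hK hsol he hP hQ hB hE₀ hcons ht₁ xp
  -- `Iio` versus `Iic` for the `P` integrals
  have hIicP : ∀ t, ∫ x in Iio xp, P (t, x) = ∫ x in Iic xp, P (t, x) :=
    fun t => setIntegral_congr_set Iio_ae_eq_Iic
  -- pointwise: the characteristic densities are `e/2 ∓ P ≥ 0`
  have hptR : ∀ t x, 0 ≤ e (t, x) / 2 - P (t, x) :=
    fun t x => sub_nonneg.2 (abs_le.1 (abs_P_le hV0 he hP (t, x))).2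
  have hptL : ∀ t x, 0 ≤ e (t, x) / 2 + P (t, x) := fun t x => by
    have := (abs_le.1 (abs_P_le hV0 he hP (t, x))).1
    linarith
  -- OUT in real terms
  have hOR : ∀ t, (∫⁻ x in Ioi xp, ENNReal.ofReal
      (2⁻¹ * ((fderiv ℝ u (t, x) (1, 0) - fderiv ℝ u (t, x) (0, 1)) ^ 2 + V x * u (t, x) ^ 2)))
      = ENNReal.ofReal (∫ x in Ioi xp, (e (t, x) / 2 - P (t, x))) := by
    intro t
    have hnn : 0 ≤ᵐ[volume.restrict (Ioi xp)] fun x => e (t, x) / 2 - P (t, x) :=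
      ae_of_all _ (hptR t)
    have hint : Integrable (fun x => e (t, x) / 2 - P (t, x)) (volume.restrict (Ioi xp)) :=
      (((hIe t).div_const 2).sub (hIP t)).integrableOn
    rw [ofReal_integral_eq_lintegral_ofReal hint hnn]
    exact lintegral_congr fun x => by
      congr 1
      simp only [he, hP]
      ring
  have hOL : ∀ t, (∫⁻ x in Iio xp, ENNReal.ofReal
      (2⁻¹ * ((fderiv ℝ u (t, x) (1, 0) + fderiv ℝ u (t, x) (0, 1)) ^ 2 + V x * u (t, x) ^ 2)))
      = ENNReal.ofReal (∫ x in Iio xp, (e (t, x) / 2 + P (t, x))) := by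
    intro t
    have hnn : 0 ≤ᵐ[volume.restrict (Iio xp)] fun x => e (t, x) / 2 + P (t, x) :=
      ae_of_all _ (hptL t)
    have hint : Integrable (fun x => e (t, x) / 2 + P (t, x)) (volume.restrict (Iio xp)) :=
      (((hIe t).div_const 2).add (hIP t)).integrableOn
    rw [ofReal_integral_eq_lintegral_ofReal hint hnn]
    exact lintegral_congr fun x => by
      congr 1
      simp only [he, hP]
      ring
  have hoR : ∀ t, ∫ x in Ioi xp, (e (t, x) / 2 - P (t, x))
      = (∫ x in Ioi xp, e (t, x)) / 2 - ∫ x in Ioi xp, P (t, x) := fun t => by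
    rw [integral_sub ((hIe t).div_const 2).integrableOn (hIP t).integrableOn, integral_div]
  have hoL : ∀ t, ∫ x in Iio xp, (e (t, x) / 2 + P (t, x))
      = (∫ x in Iio xp, e (t, x)) / 2 + ∫ x in Iio xp, P (t, x) := fun t => by
    rw [integral_add ((hIe t).div_const 2).integrableOn (hIP t).integrableOn, integral_div]
  -- conservation of the total energy, split at `xp`
  have hEtot : ∀ t, (∫ x in Ioi xp, e (t, x)) + ∫ x in Iio xp, e (t, x) = E₀.toReal := fun t => by
    have h := integral_add_compl (measurableSet_Ioi (a := xp)) (hIe t)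
    rw [compl_Ioi] at h
    rw [setIntegral_congr_set Iio_ae_eq_Iic, h,
      integral_eq_lintegral_of_nonneg_ae (ae_of_all _ fun x => he0 (t, x))
        (hec.comp (Continuous.prodMk_right t)).aestronglyMeasurable, hcons]
  -- the point term `∫₀^{t₁} Q(·, xp)`
  have hC : ∫ τ in (0:ℝ)..t₁, Q (τ, xp)
      = 1 / 2 * (∫ τ in (0:ℝ)..t₁, (fderiv ℝ u (τ, xp) (1, 0) ^ 2 + fderiv ℝ u (τ, xp) (0, 1) ^ 2))
        - 1 / 2 * ∫ τ in (0:ℝ)..t₁, V xp * u (τ, xp) ^ 2 := by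
    have h1c : Continuous fun τ => fderiv ℝ u (τ, xp) (1, 0) ^ 2 + fderiv ℝ u (τ, xp) (0, 1) ^ 2 :=
      (((WaveEnergy.continuous_fderiv_apply hu (1, 0)).comp (Continuous.prodMk_left xp)).pow 2).add
        (((WaveEnergy.continuous_fderiv_apply hu (0, 1)).comp (Continuous.prodMk_left xp)).pow 2)
    have h2c : Continuous fun τ => V xp * u (τ, xp) ^ 2 :=
      continuous_const.mul (((WaveEnergy.differentiable_of_contDiff_two hu).continuous.comp
        (Continuous.prodMk_left xp)).pow 2)
    have hfun : (fun τ => Q (τ, xp)) = fun τ =>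
        1 / 2 * (fderiv ℝ u (τ, xp) (1, 0) ^ 2 + fderiv ℝ u (τ, xp) (0, 1) ^ 2)
          - 1 / 2 * (V xp * u (τ, xp) ^ 2) := funext fun τ => by simp only [hQ]; ring
    rw [hfun, intervalIntegral.integral_sub ((h1c.intervalIntegrable _ _).const_mul _)
      ((h2c.intervalIntegrable _ _).const_mul _), intervalIntegral.integral_const_mul,
      intervalIntegral.integral_const_mul]
  -- the bulk in `|B|` form
  have hBabs : IntegrableOn (fun z => |Bk z|) (Ioc 0 t₁ ×ˢ univ) := hBstrip.abs
  have hbulk : ∫⁻ z in Ioo (0:ℝ) t₁ ×ˢ (univ : Set ℝ), ENNReal.ofReal (2⁻¹ * (|V' z.2| * u z ^ 2))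
      = ENNReal.ofReal (∫ z in Ioc (0:ℝ) t₁ ×ˢ (univ : Set ℝ), |Bk z|) := by
    have hset : (Ioo (0:ℝ) t₁ ×ˢ (univ : Set ℝ) : Set (ℝ × ℝ))
        =ᵐ[volume] (Ioc (0:ℝ) t₁ ×ˢ (univ : Set ℝ) : Set (ℝ × ℝ)) := by
      rw [Measure.volume_eq_prod]
      exact Measure.set_prod_ae_eq Ioo_ae_eq_Ioc (ae_eq_refl _)
    rw [setLIntegral_congr hset,
      ofReal_integral_eq_lintegral_ofReal hBabs (ae_of_all _ fun z => abs_nonneg (Bk z))]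
    exact lintegral_congr fun z => by rw [hB, half_abs_eq]
  have hbulk_val : ∫ z in Ioc (0:ℝ) t₁ ×ˢ (univ : Set ℝ), |Bk z|
      = (∫ z in Ioc 0 t₁ ×ˢ Ioi xp, Bk z) - ∫ z in Ioc 0 t₁ ×ˢ Iic xp, Bk z := by
    have hU : (Ioc (0:ℝ) t₁ ×ˢ (univ : Set ℝ) : Set (ℝ × ℝ))
        = Ioc 0 t₁ ×ˢ Iic xp ∪ Ioc 0 t₁ ×ˢ Ioi xp := by
      rw [← prod_union, Iic_union_Ioi]
    have hsub1 : Ioc (0:ℝ) t₁ ×ˢ Iic xp ⊆ Ioc 0 t₁ ×ˢ (univ : Set ℝ) :=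
      prod_mono le_rfl (subset_univ _)
    have hsub2 : Ioc (0:ℝ) t₁ ×ˢ Ioi xp ⊆ Ioc 0 t₁ ×ˢ (univ : Set ℝ) :=
      prod_mono le_rfl (subset_univ _)
    rw [hU, setIntegral_union (disjoint_prod.2 (Or.inr (Iic_disjoint_Ioi le_rfl)))
      (measurableSet_Ioc.prod measurableSet_Ioi) (hBabs.mono_set hsub1) (hBabs.mono_set hsub2)]
    -- right of the peak `V′ ≤ 0`: `|B| = B`
    have hr : ∫ z in Ioc (0:ℝ) t₁ ×ˢ Ioi xp, |Bk z| = ∫ z in Ioc 0 t₁ ×ˢ Ioi xp, Bk z := by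
      refine setIntegral_congr_fun (measurableSet_Ioc.prod measurableSet_Ioi) fun z hz => ?_
      have hz2 : xp < z.2 := hz.2
      have hV'z : V' z.2 ≤ 0 := by nlinarith [hmono z.2]
      rw [hB]
      exact abs_of_nonneg (by nlinarith [sq_nonneg (u z)])
    -- left of the peak `V′ ≥ 0`: `|B| = −B` (on `Iio`, which is a.e. `Iic`)
    have hIio : (Ioc (0:ℝ) t₁ ×ˢ Iio xp : Set (ℝ × ℝ)) =ᵐ[volume] (Ioc (0:ℝ) t₁ ×ˢ Iic xp) := by
      rw [Measure.volume_eq_prod]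
      exact Measure.set_prod_ae_eq (ae_eq_refl _) Iio_ae_eq_Iic
    have hl : ∫ z in Ioc (0:ℝ) t₁ ×ˢ Iic xp, |Bk z| = -∫ z in Ioc 0 t₁ ×ˢ Iic xp, Bk z := by
      rw [← setIntegral_congr_set hIio, ← setIntegral_congr_set hIio, ← integral_neg]
      refine setIntegral_congr_fun (measurableSet_Ioc.prod measurableSet_Iio) fun z hz => ?_
      have hz2 : z.2 < xp := hz.2
      have hV'z : 0 ≤ V' z.2 := by nlinarith [hmono z.2]
      rw [hB]
      exact abs_of_nonpos (by nlinarith [sq_nonneg (u z)])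
    rw [hr, hl]
    ring
  -- nonnegativity of all the real players
  have hnnR : ∀ t, 0 ≤ ∫ x in Ioi xp, (e (t, x) / 2 - P (t, x)) :=
    fun t => setIntegral_nonneg measurableSet_Ioi fun x _ => hptR t x
  have hnnL : ∀ t, 0 ≤ ∫ x in Iio xp, (e (t, x) / 2 + P (t, x)) :=
    fun t => setIntegral_nonneg measurableSet_Iio fun x _ => hptL t x
  have hnnV : 0 ≤ ∫ τ in (0:ℝ)..t₁, V xp * u (τ, xp) ^ 2 :=
    intervalIntegral.integral_nonneg ht₁ fun τ _ => mul_nonneg (hV0 xp) (sq_nonneg _)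
  have hnnK : 0 ≤ ∫ τ in (0:ℝ)..t₁, (fderiv ℝ u (τ, xp) (1, 0) ^ 2 + fderiv ℝ u (τ, xp) (0, 1) ^ 2) :=
    intervalIntegral.integral_nonneg ht₁ fun τ _ => by positivity
  have hnnB : 0 ≤ ∫ z in Ioc (0:ℝ) t₁ ×ˢ (univ : Set ℝ), |Bk z| :=
    setIntegral_nonneg (measurableSet_Ioc.prod MeasurableSet.univ) fun z _ => abs_nonneg _
  -- assemble
  rw [hOR t₁, hOL t₁, hOR 0, hOL 0, hbulk,
    ← ENNReal.ofReal_add (hnnR t₁) (hnnL t₁),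
    ← ENNReal.ofReal_add (add_nonneg (hnnR t₁) (hnnL t₁)) hnnV,
    ← ENNReal.ofReal_add (hnnR 0) (hnnL 0),
    ← ENNReal.ofReal_add (add_nonneg (hnnR 0) (hnnL 0)) hnnK,
    ← ENNReal.ofReal_add (add_nonneg (add_nonneg (hnnR 0) (hnnL 0)) hnnK) hnnB]
  congr 1
  linarith [hoR t₁, hoR 0, hoL t₁, hoL 0, hEtot t₁, hEtot 0, hIicP t₁, hIicP 0, hR, hL, hC, hbulk_val]

end Assembly

end OutVirial

/-- **Stub `stub_outVirial` of line `Sketch` (virial law of the characteristic split, `M/L`).**  For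
`V ≥ 0` of class `C¹` with `|V′| ≤ K V`, single-peaked at `xp` (`(x − xp)V′(x) ≤ 0`), and a finite-energy
global `C²` solution `ψ`:
`OUT(t₁) + ∫₀^{t₁} V(xp)ψ(τ,xp)² dτ = OUT(0) + ∫₀^{t₁} (ψ_t² + ψ_x²)(τ,xp) dτ + ½∫₀^{t₁}∫_ℝ |V′|ψ²`,
`OUT(t) := ½∫_{x>xp}[(ψ_t−ψ_x)² + Vψ²] + ½∫_{x<xp}[(ψ_t+ψ_x)² + Vψ²]` (all in `[0,∞]`).
Proof: `OutVirial.outVirial_fderiv` (multiplier `f ≡ 1, β ≡ 0, φ = V/2` on `[0,t₁] × [xp, X]` and on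
`[0,t₁] × [X, xp]`, `X → ±∞`, conservation of the total energy) translated to the curried `deriv`
vocabulary by `WaveEnergy.deriv_slice_fst_eq/snd_eq`. [folklore] -/
theorem stub_outVirial (V V' : ℝ → ℝ) (K xp : ℝ) (hV : ∀ x, HasDerivAt V (V' x) x) (hV'c : Continuous V')
    (hV0 : ∀ x, 0 ≤ V x) (hK : ∀ x, |V' x| ≤ K * V x) (hmono : ∀ x, (x - xp) * V' x ≤ 0)
    (ψ : ℝ → ℝ → ℝ) (hψ : IsSolution V ψ) (hE : totalEnergy V ψ 0 ≠ ⊤) (t₁ : ℝ) (ht₁ : 0 ≤ t₁) :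
    (∫⁻ x in Ioi xp, ENNReal.ofReal
        (2⁻¹ * ((deriv (fun τ => ψ τ x) t₁ - deriv (ψ t₁) x) ^ 2 + V x * ψ t₁ x ^ 2)))
      + (∫⁻ x in Iio xp, ENNReal.ofReal
        (2⁻¹ * ((deriv (fun τ => ψ τ x) t₁ + deriv (ψ t₁) x) ^ 2 + V x * ψ t₁ x ^ 2)))
      + ENNReal.ofReal (∫ τ in (0:ℝ)..t₁, V xp * ψ τ xp ^ 2)
    = (∫⁻ x in Ioi xp, ENNReal.ofReal
        (2⁻¹ * ((deriv (fun τ => ψ τ x) 0 - deriv (ψ 0) x) ^ 2 + V x * ψ 0 x ^ 2)))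
      + (∫⁻ x in Iio xp, ENNReal.ofReal
        (2⁻¹ * ((deriv (fun τ => ψ τ x) 0 + deriv (ψ 0) x) ^ 2 + V x * ψ 0 x ^ 2)))
      + ENNReal.ofReal (∫ τ in (0:ℝ)..t₁, (deriv (fun τ' => ψ τ' xp) τ ^ 2 + deriv (ψ τ) xp ^ 2))
      + ∫⁻ z in Ioo (0:ℝ) t₁ ×ˢ (univ : Set ℝ), ENNReal.ofReal (2⁻¹ * (|V' z.2| * ψ z.1 z.2 ^ 2)) := by
  have hu : ContDiff ℝ 2 (Function.uncurry ψ) := hψ.1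
  have hVd : Differentiable ℝ V := fun x => (hV x).differentiableAt
  have hcons : ∀ t, ∫⁻ x, ENNReal.ofReal ((fun z : ℝ × ℝ => energyDensity V ψ z.1 z.2) (t, x))
      = totalEnergy V ψ 0 := fun t => RW.totalEnergy_eq_totalEnergy hVd hV0 hψ t 0
  have key := OutVirial.outVirial_fderiv (u := Function.uncurry ψ) hu hV hV'c hV0 hK hmono
    (RW.IsSolution.fderiv_eq hψ) (RW.energyDensity_he (V := V) hψ.1) hE hcons ht₁
  have hd1 : ∀ t x, deriv (fun τ => ψ τ x) t = fderiv ℝ (Function.uncurry ψ) (t, x) (1, 0) :=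
    WaveEnergy.deriv_slice_fst_eq hu
  have hd2 : ∀ t x, deriv (ψ t) x = fderiv ℝ (Function.uncurry ψ) (t, x) (0, 1) :=
    WaveEnergy.deriv_slice_snd_eq hu
  simp only [hd1, hd2]
  exact key

end Summit.FinalStateConjecture.FinalStateConjecture.Theorems.WindowedShellChannelsSketch

end
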